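import Literature.MathematicalPhysics.QuantumFieldTheory.Balaban1983to89.Beta.CompositionSingular
import Literature.MathematicalPhysics.QuantumFieldTheory.Balaban1983to89.B6Cov2156TorusDelK
import Summits.QuantumFields.BalabanUV.Beta.GAN24.TorusJunction
import Summits.QuantumFields.BalabanUV.Beta.GAN24.MonotoneTorusEffective

/-!
# `BalabanUV.Beta.FP.OneShotEffectiveForm` — road «FP» for binder row D1, row **GAMMA-1** (owner ruling R-FP-25, `HOME/b2b-balaban-beta-d1-p3/GAMMA-DESIGN.md`
# §2∕§7∕§9, LEAVES-FP l.350∕l.362; first refusal gan24-p1∕p3 lineages): **(G1-a) AT FINITE LEVEL ON EVERY TORUS, IN THE ROAD'S OWN CURRENCY** —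
# the `λλ`-corner `𝔊 = effForm` of the one shot's bordered inverse (the leg of `FP/KKTSecondVariation.sixLoops_kkt`), evaluated at `U = 1` on the
# typed B5 §D∕§E system of the tree, IS Bałaban's (1.65) operator `Δ_k` (times the weight `n^d = η^{−d}` of the scalar product (1.21)):
# `effForm (Kop n M) (QvOp n M) = n^d • DelK`, `minOp (Kop n M) (QvOp n M) = H_k` (1.103), `flucCov (Kop n M) (QvOp n M) = 𝒞 + G∂R∂ᴴG`,
# and — junction to an2's kernel — the torus-periodised multiplier–multiplier block of the packed resolvent `KInv N` IS that corner
# ([folklore] finite-dimensional algebra over TREE definitions and theorems BY NAME; «not in print; our proof» for the junction line)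

HONEST DEPENDENCY (page 1, mandatory): continuum YM on T⁴ ⇐ BetaPertH ∧ nine spine estimates (0/9 proved); BetaPertH ⇐ (D1) ∧ (D4) ∧
CAP+tail; G-an2-4 gates asym, D1 and NE2/3/4.  HONEST FRAMING (cell contract, verbatim): «discharging `BetaPertH` makes Bałaban's UV
stability UNCONDITIONAL — a real constructive-QFT result; it is NOT the continuum limit and NOT the Clay problem.»  THIS MODULE proves NO NEW estimate
(its one decay statement, `effForm_re_decay`, is pv09's certified (1.66)-kernel decay BY NAME), instantiates NO wall binder, defines nothing, cites nothing
as a hypothesis; 0 sorry.  NEVER «G-an2-4 closed»; NOT (CONV-C) for `G_k∕H_k`, NOT hbook,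
NOT D1, NOT BetaPertH, NOT continuum, NOT Clay.

ABSOLUTE RULE (cell charter, verbatim): «No internally-minted statement may enter as a cited fact. Every hypothesis is either kernel-proved in this
package or a verbatim quotation of a PUBLISHED theorem with page reference. The manuscript(s) under audit are NOT citable for their own disputed
steps — they are the thing under adjudication; programme-internal (2001/route/tribunal) claims are never citable.»

WHY (GAMMA-DESIGN §2, §9).  In organisation γ the one shot is read off `kkt(H_cov, Q)⁻¹ = [[Γ, 𝓘],[𝓘ᵀ, −𝔊]]` (`CompositionSingular.flucCov ∕ minOp ∕ effForm`) and
every coarse object is to be the EXPLICIT `𝔊`; §9 located that «`𝔊` explicit» = [`effForm` = value form ✓ `SliceSaturation`] + [the (1.65) = (1.66)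
identification].  THE LOCATED FACT that makes the torus instance one line of algebra: b05's `Beta.BlockEffectiveAction.Kop n M = ½·curlᴴcurl + ∂(1 − PcT)∂ᴴ`
with `PcT = Δ⁻¹Q′ᴴ(Q′Δ⁻²Q′ᴴ)⁻¹Q′Δ⁻¹` (`B5Value126`, (1.26)∕(1.70)) IS γ's `H_cov(𝟙) = H₀ + EᵀE` with `Π = 1 − PcT` (GAMMA-DESIGN §3: `1 − Π = Δ⁻¹Q′ᵀMid⁻¹Q′Δ⁻¹`),
and Bałaban's `Δ_a = Kop + a•Q*Q` (`B5DeltaA169.DeltaA`, `Q* = QvAdj = n^d•Qᴴ`, `Q = QvOp` real) is the TILT `K = H + QᵀAQ` of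
`CompositionSingular.blocks_eq_of_reg` with `A = (a·n^d)•1`; its block propagator `Q K⁻¹ Qᵀ` is `n^{−d}•QGQ*` (`FluctuationProjection.QGQ`, invertible ✓), so
`effForm = (QK⁻¹Qᵀ)⁻¹ − A = n^d•((QGQ*)⁻¹ − a) = n^d•Δ_k` by `BlockEffectiveAction.DelK_eq` — «(1.65) = `(QG₁Q*)⁻¹ − a`».

CONTENT (every `d`, every `n ≥ 1`, every torus `M`, every dummy `a > 0` — all right-hand sides `a`-free by `DelK_indep`∕`Hk_indep`∕`Cov_indep`):
* §1 `QvOp_conjTranspose_eq_transpose` (the averaging matrix is real), `QvAdj_eq_smul_transpose`, `DeltaA_eq_tilt`, `isUnit_tilt_det`, `blockProp_tilt_eq`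
  (`= n^{−d}•QGQ*`), `isUnit_blockProp_tilt_det`.
* §2 **`isUnit_kkt_det`** — the one-shot KKT `kkt (Kop n M) (QvOp n M)` IS invertible although `Kop` is singular (`Kop_mulVec_const`): `CompositionSingular.isUnit_kkt_det_of_reg`.
* §3 **`effForm_eq_smul_DelK : effForm (Kop n M) (QvOp n M) = ((n:ℂ)^d) • DelK n hn M a ha`**; `effForm_conjTranspose`, `effForm_posSemidef`;
  **`effForm_form_eq_formDk`**: `Bᴴ·effForm·B = n^d · formDk n M B` — the PRINTED (1.66) form (`B5Hk163Form166.DelK_form_eq_formDk` BY NAME); `effForm_isReal`,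
  `effForm_transpose` (real symmetric); **`effForm_re_decay`** — GAMMA-1's LETTERS AT FINITE VOLUME: `|Re 𝔊(s,s′)| ≤ n^d·c₀·e^{−δ₀ρ_M(s₋,s′₋)}` with `c₀, δ₀ > 0`
  depending on `d` ONLY (uniform in the level `n = Lc^k` and in the torus `M`; pv09's `B6Cov2156TorusDelK.re_DelK_decay` BY NAME).
* §4 **`minOp_eq_Hk : minOp (Kop n M) (QvOp n M) = Hk n hn M a ha`** (the minimiser block IS (1.103) `GQ*(QGQ*)⁻¹`); `QvOp_mul_minOp` re-derived.
* §5 `flucCov_eq` (`= G − H_k·Q·G`) and **`flucCov_eq_Cov_add`**: `flucCov (Kop n M) (QvOp n M) = Cov n hn M a ha + G·∂(1−PcT)∂ᴴ·G` — γ's SOFT-slice fluctuation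
  covariance `Γ` and b05's SHARP-gauge constrained covariance `𝒞 = 𝒫G` (1.107) differ by the explicit longitudinal piece (located, exact).
* §6 JUNCTION TO an2's KERNEL (dimension `d+1`, leaf-18's `GAN24.TorusJunction.tsum_wΦ_pshift_eq_DelK` BY NAME): **`tsum_wΦ_pshift_eq_effForm`**:
  `∑' t, wΦ (N := N) κ l (z + pshift M t) = 2·((N:ℝ)^(d+5))⁻¹·(((N:ℝ)^(d+1))⁻¹·(effForm (Kop N M) (QvOp N M) (toTor M z, κ) (0, l)).re)` — the `M`-periodised
  multiplier–multiplier block of the packed resolvent `KInv N` (`OneStepResolventKernel`) IS the `λλ`-corner of the road's one-shot bordered inverse on the torus,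
  unit `2·N^{−(2D+4)}` (`D = d+1`: `2` = an2's `curvAdj∘curv = 2·∂ᴴ∂`, `N^{−(D+4)}` = block-SUM normalisation, `N^{−D}` = the weight above).
* §7 JUNCTION TO ROAD P4 (gan24-p4's `GAN24.MonotoneTorusEffective` BY NAME): **`effAction_eq_smul_effForm`** — road P4's SHORTED form of the level-`k` curl energy
  (`effAction Lc M k = shortForm …`, no gauge fixing, canonical) IS `2·n^{−d}` times the bordered-inverse corner, `n = Lc^k`; and **`effForm_weighted_mono`** — the weighted
  corner `n^{−d}•effForm (Kop n M) (QvOp n M)` is LOEWNER-MONOTONE in the level (`k ≤ k′`; `MonotoneTorusEffective.DelK_mono`, Federbush + (1.17), no rate).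
READING FOR THE ROAD (records, not theorems of this file): with `n = Lc^k` this is «`𝔊` explicit» at every finite level on every torus: `n^d•Δ_k` = the (1.66)
matrix (`B6Cov2156TorusDelK.deltaPol_eq_DelK` ✓) → `deltaZ Lc k` on `ℤ^{d+1}` (`GAN24.DirichletExhaustionDeltaZ`∕`MultiplierDictionary.wΦ_eq_deltaZ` ✓) → `deltaZLim = Δ_∞`
at rate `(Lc⁻²)^k` (`GAN24.EffectiveLaplacianLimit` ✓); the (j, m) family is the semigroup (`FP/CoarseFormSemigroup` ✓) + X1m-mm (`FP/ConvergenceJMMultiplier` ✓,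
`FP/PerfectSymbolKMultiplier` ✓); another saturated slice gives the same `effForm` (`FP/SliceSaturation.effForm_eq_of_saturated_slices` ✓).  NOT claimed: anything at
`U ≠ 1` (row IR-5′), any new estimate, the COVARIANT (j, m) KKT object itself (IR-5′ types it; this file is its `U = 1` value).
Provenance: unit b2b-balaban-gan24-p3 gen 20 (prover-b2b-balaban-gan24-p3-g20-0), 2026-08-21, row GAMMA-1 (torus instance).
-/

noncomputable section

open scoped BigOperators Matrix ComplexConjugate ComplexOrder

namespace Summit.QuantumFields.BalabanUV.Beta.FP.OneShotEffectiveForm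

open Literature.MathematicalPhysics.QuantumFieldTheory.Balaban1983to89.B5Prop11Plancherel (Tor fine calG)
open Literature.MathematicalPhysics.QuantumFieldTheory.Balaban1983to89.B5Block118 (QvOp)
open Literature.MathematicalPhysics.QuantumFieldTheory.Balaban1983to89.B5Action121 (GradOp CurlOp)
open Literature.MathematicalPhysics.QuantumFieldTheory.Balaban1983to89.B5Value126 (PcT)
open Literature.MathematicalPhysics.QuantumFieldTheory.Balaban1983to89.B5DeltaA169 (DeltaA QvAdj calG_eq_DeltaA_inv isUnit_DeltaA)
open Literature.MathematicalPhysics.QuantumFieldTheory.Balaban1983to89.B5Hk163Form166 (DelK_form_eq_formDk)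
open Literature.MathematicalPhysics.QuantumFieldTheory.Balaban1983to89.B5Bounds167Lattice (formDk)
open Literature.MathematicalPhysics.QuantumFieldTheory.Balaban1983to89.B5RealFields (IsReal isReal_iff_conjTranspose isReal_QvOp)
open Literature.MathematicalPhysics.QuantumFieldTheory.Balaban1983to89.B6BondEliminationTorus (pdist)
open Literature.MathematicalPhysics.QuantumFieldTheory.Balaban1983to89.B6LowerBound2153Torus (rep)
open Literature.MathematicalPhysics.QuantumFieldTheory.Balaban1983to89.B6Cov2156Torus (one_le_M)
open Literature.MathematicalPhysics.QuantumFieldTheory.Balaban1983to89.B6Cov2156TorusDelK (isReal_DelK re_DelK_decay)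
open Literature.MathematicalPhysics.QuantumFieldTheory.Balaban1983to89.Beta.FluctuationProjection (QGQ Hk Cov Cov_eq isUnit_QGQ_det
  QGQ_inv_mul)
open Literature.MathematicalPhysics.QuantumFieldTheory.Balaban1983to89.Beta.BlockEffectiveAction (Kop DelK DeltaA_eq_Kop_add DelK_eq
  DelK_posSemidef DelK_conjTranspose)
open Literature.MathematicalPhysics.QuantumFieldTheory.Balaban1983to89.Beta.Composition (kkt blockProp)
open Literature.MathematicalPhysics.QuantumFieldTheory.Balaban1983to89.Beta.CompositionSingular (effForm minOp flucCov blocks_eq_of_reg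
  isUnit_kkt_det_of_reg mul_minOp)
open Literature.MathematicalPhysics.QuantumFieldTheory.Balaban1983to89.Beta.Envelope (constrProp minMap blockProp_eq)
open Literature.MathematicalPhysics.QuantumFieldTheory.Balaban1983to89.Beta.KernelSpecInstance (wΦ)
open Literature.MathematicalPhysics.QuantumFieldTheory.Balaban1983to89.Beta.AffineAveraging (Site)
open Summit.QuantumFields.BalabanUV.Beta.GAN24.TorusAvatar (toTor)
open Summit.QuantumFields.BalabanUV.Beta.GAN24.TorusPeriodise (pshift)
open Summit.QuantumFields.BalabanUV.Beta.GAN24.TorusJunction (tsum_wΦ_pshift_eq_DelK)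
open Summit.QuantumFields.BalabanUV.Beta.GAN24.MonotoneTorusEffective (effAction effAction_eq_two_smul_DelK DelK_mono one_le_pow_Lc)
open Matrix

/-! ## §1 The tilt: Bałaban's `Δ_a` is `Kop + Qᵀ((a·n^d)•1)Q`, its block propagator is `n^{−d}•QGQ*` -/

section Torus

variable {d : ℕ} (n : ℕ) [NeZero n] (hn : 1 ≤ n) (M : Fin d → ℕ) [hM : ∀ μ, NeZero (M μ)] (a : ℝ) (ha : 0 < a)

omit [NeZero n] hM in
/-- [folklore] THE AVERAGING MATRIX (1.18) IS REAL: `(QvOp n M)ᴴ = (QvOp n M)ᵀ` (`B5RealFields.isReal_QvOp` BY NAME). -/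
theorem QvOp_conjTranspose_eq_transpose : (QvOp n M)ᴴ = (QvOp n M)ᵀ :=
  isReal_iff_conjTranspose.mp (isReal_QvOp n M)

omit [NeZero n] hM in
/-- [folklore] `Q* = n^d • Qᵀ` (B5's weighted adjoint `QvAdj = n^d•Qᴴ`, and `Q` is real). -/
theorem QvAdj_eq_smul_transpose : QvAdj n M = ((n : ℂ) ^ d) • (QvOp n M)ᵀ := by
  rw [QvAdj, QvOp_conjTranspose_eq_transpose]

/-- [folklore] **BAŁABAN'S `Δ_a` IS THE TILT OF γ's `H_cov(𝟙) = Kop`**: `DeltaA n M a = Kop n M + Qᵀ·((a·n^d)•1)·Q`. -/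
theorem DeltaA_eq_tilt :
    DeltaA n M a = Kop n M + (QvOp n M)ᵀ * (((a : ℂ) * (n : ℂ) ^ d) • (1 : Matrix (Tor M × Fin d) (Tor M × Fin d) ℂ)) * QvOp n M := by
  rw [DeltaA_eq_Kop_add n M a, QvAdj_eq_smul_transpose, Matrix.mul_smul, Matrix.mul_one, Matrix.smul_mul, Matrix.smul_mul,
    smul_smul]

include hn ha in
/-- [folklore] The tilted form is invertible (`Δ_a` is: `B5DeltaA169.isUnit_DeltaA`). -/
theorem isUnit_tilt_det :
    IsUnit (Kop n M + (QvOp n M)ᵀ * (((a : ℂ) * (n : ℂ) ^ d) • (1 : Matrix (Tor M × Fin d) (Tor M × Fin d) ℂ)) * QvOp n M).det := by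
  rw [← DeltaA_eq_tilt, ← Matrix.isUnit_iff_isUnit_det]
  exact isUnit_DeltaA n hn M a ha

include hn ha in
/-- [folklore] **THE BLOCK PROPAGATOR OF THE TILT IS `n^{−d}•QGQ*`**: `Q·Δ_a⁻¹·Qᵀ = n^{−d} • (Q·G·Q*)`. -/
theorem blockProp_tilt_eq :
    blockProp (Kop n M + (QvOp n M)ᵀ * (((a : ℂ) * (n : ℂ) ^ d) • (1 : Matrix (Tor M × Fin d) (Tor M × Fin d) ℂ)) * QvOp n M) (QvOp n M)
      = ((n : ℂ) ^ d)⁻¹ • QGQ n hn M a ha := by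
  have hnd : ((n : ℂ) ^ d) ≠ 0 := pow_ne_zero _ (Nat.cast_ne_zero.mpr (NeZero.ne n))
  rw [blockProp_eq, ← DeltaA_eq_tilt, ← calG_eq_DeltaA_inv n hn M a ha, QGQ, QvAdj_eq_smul_transpose, Matrix.mul_smul,
    smul_smul, inv_mul_cancel₀ hnd, one_smul]

include hn ha in
/-- [folklore] … hence invertible (`FluctuationProjection.isUnit_QGQ_det`). -/
theorem isUnit_blockProp_tilt_det :
    IsUnit (blockProp (Kop n M + (QvOp n M)ᵀ * (((a : ℂ) * (n : ℂ) ^ d) • (1 : Matrix (Tor M × Fin d) (Tor M × Fin d) ℂ)) * QvOp n M)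
      (QvOp n M)).det := by
  have hnd : ((n : ℂ) ^ d) ≠ 0 := pow_ne_zero _ (Nat.cast_ne_zero.mpr (NeZero.ne n))
  rw [blockProp_tilt_eq n hn M a ha, Matrix.det_smul, IsUnit.mul_iff]
  exact ⟨isUnit_iff_ne_zero.mpr (pow_ne_zero _ (inv_ne_zero hnd)), isUnit_QGQ_det n hn M a ha⟩

include hn ha in
/-- [folklore] The inverse of the tilt's block propagator: `(Q·Δ_a⁻¹·Qᵀ)⁻¹ = n^d • (QGQ*)⁻¹`. -/
theorem blockProp_tilt_inv_eq :
    (blockProp (Kop n M + (QvOp n M)ᵀ * (((a : ℂ) * (n : ℂ) ^ d) • (1 : Matrix (Tor M × Fin d) (Tor M × Fin d) ℂ)) * QvOp n M) (QvOp n M))⁻¹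
      = ((n : ℂ) ^ d) • (QGQ n hn M a ha)⁻¹ := by
  have hnd : ((n : ℂ) ^ d) ≠ 0 := pow_ne_zero _ (Nat.cast_ne_zero.mpr (NeZero.ne n))
  rw [blockProp_tilt_eq n hn M a ha]
  refine Matrix.inv_eq_left_inv ?_
  rw [Matrix.smul_mul, Matrix.mul_smul, smul_smul, QGQ_inv_mul n hn M a ha, mul_inv_cancel₀ hnd, one_smul]

/-! ## §2 The one-shot KKT at `U = 1` is invertible (although `Kop` is singular) -/

include hn ha in
/-- [folklore] **`kkt (Kop n M) (QvOp n M)` IS INVERTIBLE** — the bordered matrix `[[H_cov(𝟙), Qᵀ],[Q, 0]]` of the one shot on the torus; `Kop` itself is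
singular (`BlockEffectiveAction.Kop_mulVec_const`). From `CompositionSingular.isUnit_kkt_det_of_reg` at the tilt `A = (a·n^d)•1` (any `a > 0`). -/
theorem isUnit_kkt_det : IsUnit (kkt (Kop n M) (QvOp n M)).det :=
  isUnit_kkt_det_of_reg (Kop n M) (QvOp n M) _ (isUnit_tilt_det n hn M a ha) (isUnit_blockProp_tilt_det n hn M a ha)

/-! ## §3 The effective form IS (1.65) -/

include hn ha in
/-- **(G1-a) ON THE TORUS: `effForm (Kop n M) (QvOp n M) = n^d • Δ_k`** — the `λλ`-corner (with its sign) of the one shot's bordered inverse at `U = 1` is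
`η^{−d}` times Bałaban's (1.65) operator `DelK` (`= (QGQ*)⁻¹ − a`, `BlockEffectiveAction.DelK_eq`; `a`-free, `DelK_indep`). [folklore] -/
theorem effForm_eq_smul_DelK : effForm (Kop n M) (QvOp n M) = ((n : ℂ) ^ d) • DelK n hn M a ha := by
  rw [(blocks_eq_of_reg (Kop n M) (QvOp n M) _ (isUnit_tilt_det n hn M a ha) (isUnit_blockProp_tilt_det n hn M a ha)).1,
    blockProp_tilt_inv_eq n hn M a ha, DelK_eq, smul_sub, smul_smul, mul_comm ((n : ℂ) ^ d) (a : ℂ)]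

include hn ha in
/-- [folklore] `effForm (Kop n M) (QvOp n M)` is Hermitian. -/
theorem effForm_conjTranspose : (effForm (Kop n M) (QvOp n M))ᴴ = effForm (Kop n M) (QvOp n M) := by
  rw [effForm_eq_smul_DelK n hn M a ha, Matrix.conjTranspose_smul, DelK_conjTranspose, star_pow, star_natCast]

include hn ha in
/-- [folklore] `effForm (Kop n M) (QvOp n M)` is positive semidefinite (`Δ_k ≥ 0`, `BlockEffectiveAction.DelK_posSemidef`). -/
theorem effForm_posSemidef : (effForm (Kop n M) (QvOp n M)).PosSemidef := by
  rw [effForm_eq_smul_DelK n hn M a ha]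
  have hnd : (0 : ℂ) ≤ (n : ℂ) ^ d := by
    rw [show ((n : ℂ) ^ d) = (((n : ℝ) ^ d : ℝ) : ℂ) by push_cast; ring]
    exact Complex.zero_le_real.mpr (by positivity)
  exact (DelK_posSemidef n hn M a ha).smul hnd

include hn ha in
/-- **THE PRINTED (1.66) FORM**: `Bᴴ·effForm·B = n^d · formDk n M B` (`B5Hk163Form166.DelK_form_eq_formDk` BY NAME — the (1.65)↔(1.66) dictionary of the tree).
[folklore] -/
theorem effForm_form_eq_formDk (B : Tor M × Fin d → ℂ) :
    star B ⬝ᵥ (effForm (Kop n M) (QvOp n M) *ᵥ B) = (n : ℂ) ^ d * ((formDk n M B : ℝ) : ℂ) := by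
  rw [effForm_eq_smul_DelK n hn M a ha, Matrix.smul_mulVec, dotProduct_smul, DelK_form_eq_formDk n hn M a ha, smul_eq_mul]

include hn ha in
/-- [folklore] `effForm (Kop n M) (QvOp n M)` is a REAL matrix (`B6Cov2156TorusDelK.isReal_DelK` BY NAME). -/
theorem effForm_isReal : IsReal (effForm (Kop n M) (QvOp n M)) := by
  rw [effForm_eq_smul_DelK n hn M a ha]
  exact IsReal.smul (by rw [map_pow, map_natCast]) (isReal_DelK n hn M a ha)

include hn ha in
/-- [folklore] … hence SYMMETRIC as a complex matrix: `(effForm (Kop n M) (QvOp n M))ᵀ = effForm (Kop n M) (QvOp n M)` (real + Hermitian). -/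
theorem effForm_transpose : (effForm (Kop n M) (QvOp n M))ᵀ = effForm (Kop n M) (QvOp n M) := by
  rw [← isReal_iff_conjTranspose.mp (effForm_isReal n hn M a ha), effForm_conjTranspose n hn M a ha]

/-- **GAMMA-1's LETTERS AT FINITE VOLUME, UNIFORM IN THE LEVEL AND THE TORUS**: there are `c₀, δ₀ > 0` depending on `d` only such that on every torus `M`,
for every blocking `n ≥ 1` (every level `k`, `n = Lc^k`) `|Re 𝔊(s, s′)| ≤ n^d·c₀·e^{−δ₀·ρ_M(s₋, s′₋)}`, `𝔊 = effForm (Kop n M) (QvOp n M)`, `ρ_M` the periodic distance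
(`B6BondEliminationTorus.pdist`) — pv09's `B6Cov2156TorusDelK.re_DelK_decay` ((1.66) kernel decay through the (1.65) = (1.66) junction) BY NAME through §3. [folklore] -/
theorem effForm_re_decay (hd : 1 ≤ d) : ∃ c₀ δ₀ : ℝ, 0 < c₀ ∧ 0 < δ₀ ∧
    ∀ (M : Fin d → ℕ) [∀ μ, NeZero (M μ)] (n : ℕ) [NeZero n] (_hn : 1 ≤ n) (s s' : Tor M × Fin d),
      |(effForm (Kop n M) (QvOp n M) s s').re| ≤
        (n : ℝ) ^ d * (c₀ * Real.exp (-(δ₀ * pdist M (one_le_M M) (rep M s.1) (rep M s'.1)))) := by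
  obtain ⟨c₀, δ₀, hc, hδ, hK⟩ := re_DelK_decay (d := d) hd
  refine ⟨c₀, δ₀, hc, hδ, fun M _ n _ hn s s' => ?_⟩
  have h := hK M n hn 1 one_pos s s'
  rw [effForm_eq_smul_DelK n hn M 1 one_pos, Matrix.smul_apply, smul_eq_mul,
    show ((n : ℂ) ^ d) = (((n : ℝ) ^ d : ℝ) : ℂ) by push_cast; ring, Complex.re_ofReal_mul, abs_mul,
    abs_of_nonneg (by positivity : (0 : ℝ) ≤ (n : ℝ) ^ d)]
  exact mul_le_mul_of_nonneg_left h (by positivity)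

/-! ## §4 The minimiser block IS (1.103) -/

include hn ha in
/-- **`minOp (Kop n M) (QvOp n M) = H_k = G·Q*·(QGQ*)⁻¹`** (1.103) — the field response of the one shot to a prescribed block average is Bałaban's
minimiser, for every dummy `a > 0` (`FluctuationProjection.Hk_indep`). [folklore] -/
theorem minOp_eq_Hk : minOp (Kop n M) (QvOp n M) = Hk n hn M a ha := by
  rw [(blocks_eq_of_reg (Kop n M) (QvOp n M) _ (isUnit_tilt_det n hn M a ha) (isUnit_blockProp_tilt_det n hn M a ha)).2.1,
    blockProp_tilt_inv_eq n hn M a ha, ← DeltaA_eq_tilt, ← calG_eq_DeltaA_inv n hn M a ha, Hk, QvAdj_eq_smul_transpose]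
  simp only [Matrix.mul_smul, Matrix.smul_mul, Matrix.mul_assoc]

include hn ha in
/-- [folklore] `Q · minOp = 1` — the minimiser reproduces the block averages (`CompositionSingular.mul_minOp`; = `FluctuationProjection.QvOp_mul_Hk`). -/
theorem QvOp_mul_minOp : QvOp n M * minOp (Kop n M) (QvOp n M) = 1 :=
  mul_minOp (Kop n M) (QvOp n M) (isUnit_kkt_det n hn M a ha)

/-! ## §5 The fluctuation covariance: soft slice (γ) versus sharp gauge (B5 (1.107)) -/

include hn ha in
/-- [folklore] **`flucCov (Kop n M) (QvOp n M) = G − H_k·Q·G`**, `G = Δ_a⁻¹` (`CompositionSingular.blocks_eq_of_reg`: the constrained propagator of the tilt). -/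
theorem flucCov_eq :
    flucCov (Kop n M) (QvOp n M) = calG n hn M a ha - Hk n hn M a ha * QvOp n M * calG n hn M a ha := by
  rw [(blocks_eq_of_reg (Kop n M) (QvOp n M) _ (isUnit_tilt_det n hn M a ha) (isUnit_blockProp_tilt_det n hn M a ha)).2.2,
    constrProp, minMap, blockProp_tilt_inv_eq n hn M a ha, ← DeltaA_eq_tilt, ← calG_eq_DeltaA_inv n hn M a ha, Hk,
    QvAdj_eq_smul_transpose]
  simp only [Matrix.mul_smul, Matrix.smul_mul, Matrix.mul_assoc]

include hn ha in
/-- **SOFT SLICE VS SHARP GAUGE**: `flucCov (Kop n M) (QvOp n M) = 𝒞 + G·∂(1 − PcT)∂ᴴ·G` — γ's `Γ = ((kkt H_cov Q)⁻¹)₁₁` (gauge term as the penalty `∂R∂ᴴ` inside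
`H_cov`) and b05's constrained covariance `𝒞 = 𝒫G = G − G∂R∂*G − GQ*(QGQ*)⁻¹QG` ((1.107), conditioned on `QA = 0` AND `R∂*A = 0`) differ by the explicit
longitudinal piece `G∂R∂ᴴG`. [folklore] -/
theorem flucCov_eq_Cov_add :
    flucCov (Kop n M) (QvOp n M)
      = Cov n hn M a ha
        + calG n hn M a ha * (GradOp (fine n M) (n : ℂ) * ((1 - PcT n M (n : ℂ)) * ((GradOp (fine n M) (n : ℂ))ᴴ * calG n hn M a ha))) := by
  rw [flucCov_eq n hn M a ha, Cov_eq n hn M a ha, Hk]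
  simp only [Matrix.mul_assoc]
  abel

end Torus

/-! ## §6 Junction to an2's packed resolvent kernel (dimension `d + 1`) -/

section Junction

variable {d : ℕ} (N : ℕ) [NeZero N] (hN : 1 ≤ N) (M : Fin (d + 1) → ℕ) [∀ ν, NeZero (M ν)] (a : ℝ) (ha : 0 < a)

include hN ha in
/-- **THE PERIODISED MULTIPLIER–MULTIPLIER BLOCK OF an2's PACKED RESOLVENT IS THE `λλ`-CORNER OF THE ONE SHOT'S BORDERED INVERSE ON THE TORUS**
(«not in print; our proof»: leaf-18's `GAN24.TorusJunction.tsum_wΦ_pshift_eq_DelK` + §3): for every `N ≥ 1`, every torus `M`, every `z ∈ ℤ^{d+1}`,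
`Σ_t wΦ^{(N)}_{κl}(z + M•t) = 2·N^{−(d+5)}·N^{−(d+1)}·Re 𝔊((z mod M, κ), (0, l))`, `𝔊 = effForm (Kop N M) (QvOp N M)`. -/
theorem tsum_wΦ_pshift_eq_effForm (κ l : Fin (d + 1)) (z : Site (d + 1)) :
    ∑' t : Site (d + 1), wΦ (N := N) κ l (z + pshift M t)
      = 2 * ((N : ℝ) ^ (d + 5))⁻¹ * ((((N : ℝ) ^ (d + 1))⁻¹) * (effForm (Kop N M) (QvOp N M) (toTor M z, κ) (0, l)).re) := by
  have hNd : ((N : ℂ) ^ (d + 1)) ≠ 0 := pow_ne_zero _ (Nat.cast_ne_zero.mpr (NeZero.ne N))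
  rw [tsum_wΦ_pshift_eq_DelK N hN M a ha, effForm_eq_smul_DelK N hN M a ha, Matrix.smul_apply, smul_eq_mul]
  congr 1
  rw [show ((N : ℂ) ^ (d + 1)) = (((N : ℝ) ^ (d + 1) : ℝ) : ℂ) by push_cast; ring, Complex.re_ofReal_mul, ← mul_assoc,
    inv_mul_cancel₀ (pow_ne_zero _ (Nat.cast_ne_zero.mpr (NeZero.ne N))), one_mul]

end Junction

/-! ## §7 Junction to road P4's shorted form (the same torus, blocking `n = Lc^k`) -/

section RoadP4

variable {d : ℕ} (Lc : ℕ) [NeZero Lc] (M : Fin d → ℕ) [hM : ∀ μ, NeZero (M μ)]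

/-- **ROAD P4's SHORTED FORM IS `2·n^{−d}` TIMES THE BORDERED-INVERSE CORNER**: `effAction Lc M k = (2·((Lc^k)^d)⁻¹) • effForm (Kop (Lc^k) M) (QvOp (Lc^k) M)`
(gan24-p4's `MonotoneTorusEffective.effAction_eq_two_smul_DelK` + §3; the `2` is the ordered-pair count of p4's `curlEnergy` against the `½` of (1.21)). [folklore] -/
theorem effAction_eq_smul_effForm (k : ℕ) :
    effAction Lc M k = ((2 : ℂ) * ((((Lc ^ k : ℕ) : ℂ)) ^ d)⁻¹) • effForm (Kop (Lc ^ k) M) (QvOp (Lc ^ k) M) := by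
  have hnd : ((((Lc ^ k : ℕ) : ℂ)) ^ d) ≠ 0 := pow_ne_zero _ (Nat.cast_ne_zero.mpr (NeZero.ne (Lc ^ k)))
  rw [effAction_eq_two_smul_DelK Lc M k 1 one_pos, effForm_eq_smul_DelK (Lc ^ k) (one_le_pow_Lc Lc k) M 1 one_pos, smul_smul, mul_assoc,
    inv_mul_cancel₀ hnd, mul_one]

/-- **THE WEIGHTED CORNER IS LOEWNER-MONOTONE IN THE LEVEL**: for `k ≤ k′`, `n′^{−d}•effForm (Kop n′ M) (QvOp n′ M) − n^{−d}•effForm (Kop n M) (QvOp n M) ⪰ 0`, `n = Lc^k`,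
`n′ = Lc^{k′}` — gan24-p4's `MonotoneTorusEffective.DelK_mono` (Federbush + (1.17), no rate) read through §3. [folklore] -/
theorem effForm_weighted_mono {k k' : ℕ} (h : k ≤ k') :
    (((((Lc ^ k' : ℕ) : ℂ)) ^ d)⁻¹ • effForm (Kop (Lc ^ k') M) (QvOp (Lc ^ k') M)
      - ((((Lc ^ k : ℕ) : ℂ)) ^ d)⁻¹ • effForm (Kop (Lc ^ k) M) (QvOp (Lc ^ k) M)).PosSemidef := by
  have hk : ((((Lc ^ k : ℕ) : ℂ)) ^ d) ≠ 0 := pow_ne_zero _ (Nat.cast_ne_zero.mpr (NeZero.ne (Lc ^ k)))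
  have hk' : ((((Lc ^ k' : ℕ) : ℂ)) ^ d) ≠ 0 := pow_ne_zero _ (Nat.cast_ne_zero.mpr (NeZero.ne (Lc ^ k')))
  rw [effForm_eq_smul_DelK (Lc ^ k') (one_le_pow_Lc Lc k') M 1 one_pos, effForm_eq_smul_DelK (Lc ^ k) (one_le_pow_Lc Lc k) M 1 one_pos,
    smul_smul, smul_smul, inv_mul_cancel₀ hk, inv_mul_cancel₀ hk', one_smul, one_smul]
  exact DelK_mono Lc M h 1 one_pos

end RoadP4

end Summit.QuantumFields.BalabanUV.Beta.FP.OneShotEffectiveForm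

end
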